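import Summits.ValiantsHypothesis.ValiantsHypothesis.Theorems.SymPencilSdcPerFourCellTenSixShapes
import Summits.ValiantsHypothesis.ValiantsHypothesis.Theorems.SymPencilPerFourColSixTransport
import Summits.ValiantsHypothesis.ValiantsHypothesis.Theorems.SymPencilPerFourColSixTransportTwentySeven
import Summits.ValiantsHypothesis.ValiantsHypothesis.Theorems.SymPencilPerFourW2Transport
import Summits.ValiantsHypothesis.ValiantsHypothesis.Theorems.SymPencilPerFourW2TransportTwentySeven

/-!
# Route `SymPencil` — row `r = 10` of the size-`28` table: the threshold-shifted declarations of
# `SymPencilSdcPerFourCellTenSixShapes` (`--supports` stmt-ValiantsHypothesis-5674 `SdcSuperquadratic`; rung currency only)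

The declarations below (suffix `_m28`) are those of the landed `…Theorems.SymPencilSdcPerFourCellTenSixShapes` whose meaning
changes when its numerical thresholds move by one unit — `Fin 6 → Fin 7` square families /
`|ι'| ≤ 26 → ≤ 27` / `m ≤ 27 → m ≤ 28`, as applicable — with proofs VERBATIM; unchanged
declarations are used from the original module by name (same namespace).  Why it elaborates
(m = 28 table audit, val-lit-p6 g17, 2026-08-29; reader of record val-idea-crit-5 g4, probe P31):
the leaves of the `(10, 6)` chain are stated for `card ι < 8` / `< 9`, and every size lever reads
`4·rk bL ≤ 2·dim K + |ι'|` through integer division — one unit of slack throughout.  The `_m28`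
statements imply the landed ones.

Honest framing: part of ONE row (cell `(10, 6, 7)`) of the size-`28` table; nothing about
`sdc(per_4)` follows here; `28 ≤ sdc(per_4) ≤ 29` of record, the crux `SdcSuperquadratic` and
`VP ≠ VNP` untouched.  Credit: mathematics and proof text of `SymPencilSdcPerFourCellTenSixShapes` (its authors); this file only
moves the bound.  No definitions, no named facts. [folklore]
-/

noncomputable section

-- single-conjunct layout: Sub = Summit, duplicated namespace component intended
set_option linter.dupNamespace false

namespace Summit.ValiantsHypothesis.ValiantsHypothesis.Theorems.SymPencilSdcPerFourCellTenSixShapes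

open Matrix MvPolynomial Module
open Literature.Computability.AlgebraicComplexity
open Summit.ValiantsHypothesis.ValiantsHypothesis.Theorems.SymPencilPerFourCrossSixTransport
open Summit.ValiantsHypothesis.ValiantsHypothesis.Theorems.SymPencilPerFourColSixTransport
open Summit.ValiantsHypothesis.ValiantsHypothesis.Theorems.SymPencilPerFourW2Transport

universe u

/-! ## Bookkeeping on `Fin 4` -/

variable {k : Type u} [Field k]

/-! ## The five kernel shapes of the LIST, moved to the normalised kills -/

section Shapes

variable [CharZero k] {ι' : Type*} [Fintype ι'] [DecidableEq ι']
  {D : Matrix ι' ι' k} (hD : IsUnit D.det) (hDs : Dᵀ = D)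
  (bL : (Fin 4 × Fin 4 → k) →ₗ[k] (ι' → k)) (CL : (Fin 4 × Fin 4 → k) →ₗ[k] Matrix ι' ι' k)
  (hCs : ∀ z, (CL z)ᵀ = CL z) {κ : k} (hκ : κ ≠ 0)
  (hi : ∀ z, bL z ⬝ᵥ D⁻¹ *ᵥ bL z = 0)
  (hii : ∀ z, bL z ⬝ᵥ (D⁻¹ * CL z * D⁻¹) *ᵥ bL z = 0)
  (hN : ∀ v, bL v = 0 → IsUnit (D + CL v).det ∧ ∀ (z : Fin 4 × Fin 4 → k) (s : k),
    κ * MvPolynomial.eval (v + s • z) (perPoly (Fin 4) k) =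
      (Matrix.fromBlocks ((s * 0) • (1 : Matrix Unit Unit k))
        (Matrix.replicateRow Unit (s • bL z)) (Matrix.replicateCol Unit (s • bL z))
        (D + CL v + s • CL z)).det)
  (h10 : 10 ≤ finrank k (LinearMap.range bL))

include hD hDs hCs hκ hi hii hN h10

omit hi in
/-- **`V×`-type kernels are excluded** (determinant constancy along the kernel assumed): the
kernel space is `X_{l c} ∩ {x_e = 0}` for an arm cell `e`. [folklore] -/
theorem false_of_ker_crossType_m28
    (hcard : Fintype.card ι' ≤ 27) (hdet : ∀ v, bL v = 0 → ∀ t : k, (D + t • CL v).det = D.det)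
    (l c : Fin 4) (e : Fin 4 × Fin 4) (harm : e.1 = l ∨ e.2 = c) (hne : e ≠ (l, c))
    (hW : ∀ x : Fin 4 × Fin 4 → k, bL x = 0 ↔
      ((∀ i j : Fin 4, i ≠ l → j ≠ c → x (i, j) = 0) ∧ x e = 0)) : False := by
  classical
  obtain ⟨e₁, e₂⟩ := e
  -- the zero pattern of `W`
  have hA : ∀ x : Fin 4 × Fin 4 → k, bL x = 0 ↔
      ∀ p : Fin 4 × Fin 4, ((p.1 ≠ l ∧ p.2 ≠ c) ∨ p = (e₁, e₂)) → x p = 0 := by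
    intro x
    rw [hW x]
    constructor
    · rintro ⟨h1, h2⟩ p (⟨hp1, hp2⟩ | rfl)
      · exact h1 p.1 p.2 hp1 hp2
      · exact h2
    · intro h
      exact ⟨fun i j hi' hj => h (i, j) (Or.inl ⟨hi', hj⟩), h _ (Or.inr rfl)⟩
  simp only [ne_eq, Prod.mk.injEq] at hne
  rcases harm with h1 | h2
  · -- `e` lies in the ROW arm: `e₁ = l`, `e₂ ≠ c`; transposed cross with `σ 0 = c`, `σ 3 = e₂`,
    -- `τ 0 = l`
    subst h1
    have hc : c ≠ e₂ := fun h => hne ⟨rfl, h.symm⟩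
    obtain ⟨σ, hσ0, hσ3⟩ := exists_perm_apply_eq 0 3 c e₂ (by decide) hc
    obtain ⟨τ, hτ0⟩ : ∃ τ : Equiv.Perm (Fin 4), τ 0 = e₁ :=
      ⟨Equiv.swap 0 e₁, Equiv.swap_apply_left 0 e₁⟩
    subst hσ0 hσ3 hτ0
    refine false_of_ker_eq_cross_transpose_prodCongr_m28 hD hDs bL CL hCs hκ hii hN σ τ (fun x => ?_)
      h10 hcard hdet
    rw [hA x, forall_eq_zero_iff_transpose_prodCongr σ τ]
    refine forall_congr' fun z => imp_congr ?_ Iff.rfl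
    obtain ⟨i, j⟩ := z
    simp only [ne_eq, EmbeddingLike.apply_eq_iff_eq, Prod.mk.injEq]
    revert i j
    decide
  · -- `e` lies in the COLUMN arm: `e₂ = c`, `e₁ ≠ l`; cross with `σ 0 = l`, `σ 3 = e₁`, `τ 0 = c`
    subst h2
    have hl : l ≠ e₁ := fun h => hne ⟨h.symm, rfl⟩
    obtain ⟨σ, hσ0, hσ3⟩ := exists_perm_apply_eq 0 3 l e₁ (by decide) hl
    obtain ⟨τ, hτ0⟩ : ∃ τ : Equiv.Perm (Fin 4), τ 0 = e₂ :=
      ⟨Equiv.swap 0 e₂, Equiv.swap_apply_left 0 e₂⟩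
    subst hσ0 hσ3 hτ0
    refine false_of_ker_eq_cross_prodCongr_m28 hD hDs bL CL hCs hκ hii hN σ τ (fun x => ?_)
      h10 hcard hdet
    rw [hA x, forall_eq_zero_iff_prodCongr σ τ]
    refine forall_congr' fun z => imp_congr ?_ Iff.rfl
    obtain ⟨i, j⟩ := z
    simp only [ne_eq, EmbeddingLike.apply_eq_iff_eq, Prod.mk.injEq]
    revert i j
    decide
/-- **`W_col`-type kernels are excluded**: the kernel space is `rows{p,q} × (columns ≠ m)`.
[folklore] -/
theorem false_of_ker_colType_m28
    (hcard : Fintype.card ι' ≤ 27) (p q m : Fin 4) (hpq : p ≠ q)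
    (hW : ∀ x : Fin 4 × Fin 4 → k, bL x = 0 ↔
      ((∀ i j : Fin 4, i ≠ p → i ≠ q → x (i, j) = 0) ∧ x (p, m) = 0 ∧ x (q, m) = 0)) : False := by
  classical
  have hA : ∀ x : Fin 4 × Fin 4 → k, bL x = 0 ↔
      ∀ e : Fin 4 × Fin 4, ((e.1 ≠ p ∧ e.1 ≠ q) ∨ e = (p, m) ∨ e = (q, m)) → x e = 0 := by
    intro x
    rw [hW x]
    constructor
    · rintro ⟨h1, h2, h3⟩ e (⟨he1, he2⟩ | rfl | rfl)
      · exact h1 e.1 e.2 he1 he2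
      · exact h2
      · exact h3
    · intro h
      exact ⟨fun i j hi' hj => h (i, j) (Or.inl ⟨hi', hj⟩), h _ (Or.inr (Or.inl rfl)),
        h _ (Or.inr (Or.inr rfl))⟩
  obtain ⟨σ, hσ0, hσ1⟩ := exists_perm_apply_eq 0 1 p q (by decide) hpq
  obtain ⟨τ, hτ0⟩ : ∃ τ : Equiv.Perm (Fin 4), τ 0 = m :=
      ⟨Equiv.swap 0 m, Equiv.swap_apply_left 0 m⟩
  subst hσ0 hσ1 hτ0
  refine false_of_ker_eq_colW_prodCongr_m28 hD hDs bL CL hCs hκ hi hii hN σ τ (fun x => ?_) h10 hcard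
  rw [hA x, forall_eq_zero_iff_prodCongr σ τ]
  refine forall_congr' fun z => imp_congr ?_ Iff.rfl
  obtain ⟨i, j⟩ := z
  simp only [ne_eq, EmbeddingLike.apply_eq_iff_eq, Prod.mk.injEq]
  revert i j
  decide
/-- **Transposed `W_col`-type kernels are excluded**: the kernel space is
`cols{p,q} × (rows ≠ m)`. [folklore] -/
theorem false_of_ker_colTypeT_m28
    (hcard : Fintype.card ι' ≤ 27) (p q m : Fin 4) (hpq : p ≠ q)
    (hW : ∀ x : Fin 4 × Fin 4 → k, bL x = 0 ↔
      ((∀ i j : Fin 4, j ≠ p → j ≠ q → x (i, j) = 0) ∧ x (m, p) = 0 ∧ x (m, q) = 0)) : False := by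
  classical
  have hA : ∀ x : Fin 4 × Fin 4 → k, bL x = 0 ↔
      ∀ e : Fin 4 × Fin 4, ((e.2 ≠ p ∧ e.2 ≠ q) ∨ e = (m, p) ∨ e = (m, q)) → x e = 0 := by
    intro x
    rw [hW x]
    constructor
    · rintro ⟨h1, h2, h3⟩ e (⟨he1, he2⟩ | rfl | rfl)
      · exact h1 e.1 e.2 he1 he2
      · exact h2
      · exact h3
    · intro h
      exact ⟨fun i j hi' hj => h (i, j) (Or.inl ⟨hi', hj⟩), h _ (Or.inr (Or.inl rfl)),
        h _ (Or.inr (Or.inr rfl))⟩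
  obtain ⟨σ, hσ0, hσ1⟩ := exists_perm_apply_eq 0 1 p q (by decide) hpq
  obtain ⟨τ, hτ0⟩ : ∃ τ : Equiv.Perm (Fin 4), τ 0 = m :=
      ⟨Equiv.swap 0 m, Equiv.swap_apply_left 0 m⟩
  subst hσ0 hσ1 hτ0
  refine false_of_ker_eq_colW_transpose_prodCongr_m28 hD hDs bL CL hCs hκ hi hii hN σ τ (fun x => ?_)
    h10 hcard
  rw [hA x, forall_eq_zero_iff_transpose_prodCongr σ τ]
  refine forall_congr' fun z => imp_congr ?_ Iff.rfl
  obtain ⟨i, j⟩ := z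
  simp only [ne_eq, EmbeddingLike.apply_eq_iff_eq, Prod.mk.injEq]
  revert i j
  decide
/-- **`W₂`-type kernels are excluded**: the kernel space is `row p ⊕ (row q off columns m, m')`.
[folklore] -/
theorem false_of_ker_w2Type_m28
    (hcard : Fintype.card ι' ≤ 27) (p q m m' : Fin 4) (hpq : p ≠ q) (hmm : m ≠ m')
    (hW : ∀ x : Fin 4 × Fin 4 → k, bL x = 0 ↔
      ((∀ i j : Fin 4, i ≠ p → i ≠ q → x (i, j) = 0) ∧ x (q, m) = 0 ∧ x (q, m') = 0)) : False := by
  classical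
  have hA : ∀ x : Fin 4 × Fin 4 → k, bL x = 0 ↔
      ∀ e : Fin 4 × Fin 4, ((e.1 ≠ p ∧ e.1 ≠ q) ∨ e = (q, m) ∨ e = (q, m')) → x e = 0 := by
    intro x
    rw [hW x]
    constructor
    · rintro ⟨h1, h2, h3⟩ e (⟨he1, he2⟩ | rfl | rfl)
      · exact h1 e.1 e.2 he1 he2
      · exact h2
      · exact h3
    · intro h
      exact ⟨fun i j hi' hj => h (i, j) (Or.inl ⟨hi', hj⟩), h _ (Or.inr (Or.inl rfl)),
        h _ (Or.inr (Or.inr rfl))⟩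
  obtain ⟨σ, hσ0, hσ1⟩ := exists_perm_apply_eq 0 1 p q (by decide) hpq
  obtain ⟨τ, hτ2, hτ3⟩ := exists_perm_apply_eq 2 3 m m' (by decide) hmm
  subst hσ0 hσ1 hτ2 hτ3
  refine false_of_ker_eq_W2_prodCongr_m28 hD hDs bL CL hCs hκ hi hii hN σ τ (fun x => ?_) h10 hcard
  rw [hA x, forall_eq_zero_iff_prodCongr σ τ]
  refine forall_congr' fun z => imp_congr ?_ Iff.rfl
  obtain ⟨i, j⟩ := z
  simp only [ne_eq, EmbeddingLike.apply_eq_iff_eq, Prod.mk.injEq]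
  revert i j
  decide
/-- **Transposed `W₂`-type kernels are excluded**: the kernel space is
`col p ⊕ (col q off rows m, m')`. [folklore] -/
theorem false_of_ker_w2TypeT_m28
    (hcard : Fintype.card ι' ≤ 27) (p q m m' : Fin 4) (hpq : p ≠ q) (hmm : m ≠ m')
    (hW : ∀ x : Fin 4 × Fin 4 → k, bL x = 0 ↔
      ((∀ i j : Fin 4, j ≠ p → j ≠ q → x (i, j) = 0) ∧ x (m, q) = 0 ∧ x (m', q) = 0)) : False := by
  classical
  have hA : ∀ x : Fin 4 × Fin 4 → k, bL x = 0 ↔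
      ∀ e : Fin 4 × Fin 4, ((e.2 ≠ p ∧ e.2 ≠ q) ∨ e = (m, q) ∨ e = (m', q)) → x e = 0 := by
    intro x
    rw [hW x]
    constructor
    · rintro ⟨h1, h2, h3⟩ e (⟨he1, he2⟩ | rfl | rfl)
      · exact h1 e.1 e.2 he1 he2
      · exact h2
      · exact h3
    · intro h
      exact ⟨fun i j hi' hj => h (i, j) (Or.inl ⟨hi', hj⟩), h _ (Or.inr (Or.inl rfl)),
        h _ (Or.inr (Or.inr rfl))⟩
  obtain ⟨σ, hσ0, hσ1⟩ := exists_perm_apply_eq 0 1 p q (by decide) hpq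
  obtain ⟨τ, hτ2, hτ3⟩ := exists_perm_apply_eq 2 3 m m' (by decide) hmm
  subst hσ0 hσ1 hτ2 hτ3
  refine false_of_ker_eq_W2_transpose_prodCongr_m28 hD hDs bL CL hCs hκ hi hii hN σ τ (fun x => ?_)
    h10 hcard
  rw [hA x, forall_eq_zero_iff_transpose_prodCongr σ τ]
  refine forall_congr' fun z => imp_congr ?_ Iff.rfl
  obtain ⟨i, j⟩ := z
  simp only [ne_eq, EmbeddingLike.apply_eq_iff_eq, Prod.mk.injEq]
  revert i j
  decide
end Shapes

end Summit.ValiantsHypothesis.ValiantsHypothesis.Theorems.SymPencilSdcPerFourCellTenSixShapes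

end
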